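import Literature.Barriers.SmoothPoincare4.SmallExoticaFrontierReductionProofs
import HarnessLib

/-!
# Akhmedov–Park 2010, Lemma 8 from Thm. 1 (i): the printed invariants transported from one model

Proof file (theorems only, nothing asserted) for the Seiberg–Witten leaf
`Literature.Barriers.SmoothPoincare4.akhmedovPark2010_lemma8_invariants`
(`SmallExoticaFrontierReduction.lean`, §2; fact seat `provefact-…SmoothPoincare4.akhm-b683e402a8`,
triage `SIZE: XL`, seat B "library-first / a different decomposition"). The sibling
`SmallExoticaFrontierReductionLemma8Proofs.lean` (seat A) formalises the printed PROOF of Lemma 8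
(A. Akhmedov, B. D. Park, *Exotic smooth structures on small 4-manifolds with odd signatures*,
Invent. Math. **181** (2010) 577–603 = arXiv:math/0701829, §9) up to its two non-classical
inputs — the torus-surgery / normal-connected-sum construction of `X₁(m)` and Seiberg–Witten
invariants. This file decomposes the leaf the other way, through the printed STATEMENT of
Thm. 1 (i) (§1): "Let `M` be … (i) `ℂℙ² # mℂℙ²bar` for `m = 2, 4` … Then there exist an
irreducible symplectic 4-manifold and an infinite family of pairwise non-diffeomorphic irreducible
non-symplectic 4-manifolds, all of which are homeomorphic to `M`", using only theorems of the
tree (library-first):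

1. **Transport** (`finrank_freeCohomology_eq_of_homeomorph`,
   `finrank_eq_three_and_signature_comap_eq_neg_one`): the two printed invariants of Lemma 8 —
   `b₂ = rank H²(·; ℤ)/T = 3` ("`e(X₁(m)) = 5`") and `σ = -1` — pass from a model `(M, μ)` to
   any `N ≃ₜ M` with the transported orientation
   `μ.comap e` (`freeCohomology.mapEquiv`, Hatcher §3.1; the tree's PROVED
   `HomologicalOrientation.signature_comap_holds`, Gompf–Stipsicz §1.2), as does `π₁ = 1`
   (Mathlib's `ContinuousMap.HomotopyEquiv.simplyConnectedSpace`).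
2. **The leaf from the shape of Thm. 1 (i)**
   (`akhmedovPark2010_lemma8_invariants_of_homeomorph_model`): a sequence of closed smooth
   4-manifolds, pairwise non-diffeomorphic, all homeomorphic to ONE simply connected closed
   topological 4-manifold `M` carrying an orientation with `b₂ = 3`,
   `σ = -1` (the invariants of `ℂℙ² # 2ℂℙ²bar`; `|σ| = 1` suffices, `…_of_natAbs_signature_eq_one`,
   by orientation reversal, the PROVED `HomologicalOrientation.signature_neg_holds`) yields
   `akhmedovPark2010_lemma8_invariants`. Given Wall's Thm. 2 and Freedman's Thm. 1.3 (the named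
   facts the sibling files already use) the leaf is EQUIVALENT to that shape
   (`akhmedovPark2010_lemma8_invariants_iff_homeomorph_model`; `→` takes `M := X 0`).
3. **What the vendored Thm. 1 (i) gives** (`akhmedovPark2010_exotic_bTwo_three`,
   `SmallExoticaFrontier.lean`, which records the model only through `H₂(M; ℤ) ≅ ℤ³`): its model
   is `ℤ`-orientable (simply connected; Hatcher Prop. 3.25, PROVED:
   `nonempty_homologicalOrientation_int_of_simplyConnectedSpace_holds`), has `b₂ = 3`
   (`H₂ ≅ ℤ^{b₂}`, PROVED: `nonempty_singularHomologyZ_two_iso_of_simplyConnectedSpace_holds`) and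
   `b₂⁺ + b₂⁻ = b₂` (PROVED: `finrank_eq_sigPos_add_sigNeg_intersectionForm_holds`), so
   `σ(M) ∈ {±1, ±3}` and, orienting suitably, `σ(M) ∈ {-1, -3}`
   (`exists_signature_eq_neg_one_or_eq_neg_three`). Hence
   `akhmedovPark2010_exotic_bTwo_three` yields the leaf's statement with `σ = s` for some
   `s ∈ {-1, -3}` (`exists_family_of_exotic_bTwo_three`), i.e.
   `akhmedovPark2010_lemma8_invariants ∨ (the same statement with σ = -3)`
   (`akhmedovPark2010_lemma8_invariants_or_of_exotic_bTwo_three`). The second disjunct (an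
   infinite pairwise non-diffeomorphic family with `b₂ = 3` and DEFINITE form) is not excluded by
   anything vendored: excluding it is exactly the clause "`M = ℂℙ² # 2ℂℙ²bar`" (`σ(M) = -1`,
   indefinite) that `akhmedovPark2010_exotic_bTwo_three` dropped — the residual gap of this
   decomposition, as Seiberg–Witten theory is that of the sibling's.

No `def`, no new named fact; the leaf and its users are untouched. The converse direction
(leaf ⇒ `akhmedovPark2010_exotic_bTwo_three`, given Wall and Freedman) is the sibling theorem
`akhmedovPark2010_exotic_bTwo_three_of_wall_of_freedman_of_lemma8_invariants`.

## References

* [AkhmedovPark2010] A. Akhmedov, B. D. Park, Invent. Math. 181 (2010) 577–603;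
  arXiv:math/0701829 (numbering used): §1 Thm. 1 (i), §9 Lemma 8 and its proof.
* [HatcherAT2002] A. Hatcher, *Algebraic Topology* (2002), §3.1, §3.3 Prop. 3.25, Thm. 3.30.
* [GompfStipsiczGSM1999] R. Gompf, A. Stipsicz, *4-Manifolds and Kirby Calculus* (1999), §1.2.
* [WallJLMS1964] Thm. 2; [FreedmanJDG1982] Thm. 1.3 (as hypotheses only, §2).
-/

noncomputable section

open scoped Manifold ContDiff
open CategoryTheory
open Literature.AlgebraicTopology.SingularHomology (HomologicalOrientation freeCohomology
  intersectionForm)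
open Literature.AlgebraicTopology.SingularHomology.HomologicalOrientation (signature_comap_holds
  signature_neg_holds)
open Literature.Topology.FourManifolds (singularHomologyZ
  isHCobordant_of_equivalent_intersectionForm nonempty_homeomorph_of_isHCobordant_four
  nonempty_homologicalOrientation_int_of_simplyConnectedSpace_holds
  finrank_eq_sigPos_add_sigNeg_intersectionForm_holds)

universe u

namespace Literature.Barriers.SmoothPoincare4

/-! ### §1 Transport of the printed invariants along homeomorphisms -/

/-- **`b_k` is a homeomorphism invariant**: for `e : N ≃ₜ M`, `rank Hᵏ(N; ℤ)/T = rank Hᵏ(M; ℤ)/T`,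
through the linear isomorphism `e^* : Hᵏ(M; ℤ)/T ≃ Hᵏ(N; ℤ)/T` (the tree's
`freeCohomology.mapEquiv`; Hatcher 2002, §3.1, induced homomorphisms, and §3.3 p. 250).
[cite: HatcherAT2002, §3.1 and §3.3 p. 250] -/
theorem finrank_freeCohomology_eq_of_homeomorph {M N : Type u} [TopologicalSpace M]
    [TopologicalSpace N] (e : N ≃ₜ M) (k : ℕ) :
    Module.finrank ℤ ↥(freeCohomology ℤ N k) = Module.finrank ℤ ↥(freeCohomology ℤ M k) :=
  (freeCohomology.mapEquiv (R := ℤ) e k).finrank_eq.symm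

/-- **The printed invariants of Lemma 8 are invariants of the oriented homeomorphism type.** If
`e : N ≃ₜ M` and the closed `ℤ`-oriented topological 4-manifold `(M, μ)` has
`rank H²(M; ℤ)/T = 3` and `σ(M, μ) = -1` ("`e = 5`, `σ = -1`", Akhmedov–Park 2010, proof of
Lemma 8, for the model `ℂℙ² # 2ℂℙ²bar` of Thm. 1 (i)), then so has `(N, μ.comap e)`: the rank by
`e^*` (`finrank_freeCohomology_eq_of_homeomorph`), the signature by the tree's PROVED
`HomologicalOrientation.signature_comap_holds` (Gompf–Stipsicz 1999, §1.2: `σ` is an invariant of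
the oriented homeomorphism type). [cite: AkhmedovPark2010, Thm. 1 (i) and proof of Lemma 8]
[cite: GompfStipsiczGSM1999, §1.2] -/
theorem finrank_eq_three_and_signature_comap_eq_neg_one {M N : Type u} [TopologicalSpace M]
    [T2Space M] [ChartedSpace (EuclideanSpace ℝ (Fin 4)) M] [CompactSpace M] [TopologicalSpace N]
    (μ : HomologicalOrientation ℤ M 4) (e : N ≃ₜ M)
    (hr : Module.finrank ℤ ↥(freeCohomology ℤ M 2) = 3) (hs : μ.signature = -1) :
    Module.finrank ℤ ↥(freeCohomology ℤ N 2) = 3 ∧ (μ.comap e).signature = -1 :=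
  ⟨(finrank_freeCohomology_eq_of_homeomorph e 2).trans hr, (signature_comap_holds μ e).trans hs⟩

/-! ### §2 The leaf from the shape of Thm. 1 (i): a family homeomorphic to one model -/

/-- **Akhmedov–Park 2010, Lemma 8 (as vendored) from the shape of Thm. 1 (i).** Let `M` be a
simply connected closed topological 4-manifold with a `ℤ`-orientation `μ` such that
`rank H²(M; ℤ)/T = 3` and `σ(M, μ) = -1` (the model `ℂℙ² # 2ℂℙ²bar`: "`e = 5`, `σ = -1`"), and
let `N₀, N₁, …` be closed smooth 4-manifolds, pairwise non-diffeomorphic, each homeomorphic to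
`M` ("an infinite family of pairwise non-diffeomorphic … 4-manifolds, all of which are
homeomorphic to `M`", Thm. 1 (i)). **Then `akhmedovPark2010_lemma8_invariants` holds**, with
`X := N` and the transported orientations `μ.comap eᵢ`: simple connectivity, `b₂ = 3` and `σ = -1`
are carried along the homeomorphisms `eᵢ : Nᵢ ≃ₜ M` (§1 and Mathlib's
`ContinuousMap.HomotopyEquiv.simplyConnectedSpace`). The input not supplied — such a family — is
Thm. 1 (i) itself (Seiberg–Witten theory). [cite: AkhmedovPark2010, Thm. 1 (i) and Lemma 8] -/
theorem akhmedovPark2010_lemma8_invariants_of_homeomorph_model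
    (M : Type) [TopologicalSpace M] [T2Space M] [ChartedSpace (EuclideanSpace ℝ (Fin 4)) M]
    [CompactSpace M] [SimplyConnectedSpace M] (μ : HomologicalOrientation ℤ M 4)
    (hr : Module.finrank ℤ ↥(freeCohomology ℤ M 2) = 3) (hs : μ.signature = -1)
    (N : ℕ → Type) [∀ i, TopologicalSpace (N i)] [∀ i, T2Space (N i)]
    [∀ i, SecondCountableTopology (N i)] [∀ i, ChartedSpace (EuclideanSpace ℝ (Fin 4)) (N i)]
    [∀ i, IsManifold (𝓡 4) ∞ (N i)] [∀ i, CompactSpace (N i)]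
    (he : ∀ i, Nonempty (N i ≃ₜ M)) (hN : ∀ i j, Nonempty (N i ≃ₘ⟮𝓡 4, 𝓡 4⟯ N j) → i = j) :
    akhmedovPark2010_lemma8_invariants := by
  have e : ∀ i, N i ≃ₜ M := fun i => (he i).some
  exact ⟨N, fun _ => inferInstance, fun _ => inferInstance, fun _ => inferInstance,
    fun _ => inferInstance, fun _ => inferInstance, fun _ => inferInstance,
    fun i => (e i).toHomotopyEquiv.simplyConnectedSpace, fun i => μ.comap (e i),
    fun i => finrank_eq_three_and_signature_comap_eq_neg_one μ (e i) hr hs, hN⟩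

/-- **The same with `|σ(M)| = 1`**: the sign of the model's signature is immaterial, reversing the
orientation if `σ(M, μ) = 1` (`σ(M, -μ) = -σ(M, μ)`, the tree's PROVED
`HomologicalOrientation.signature_neg_holds`; Gompf–Stipsicz 1999, §1.2, `σ(M̄) = -σ(M)` — as for
`ℂℙ²bar`, "`ℂℙ²` equipped with the opposite orientation", Akhmedov–Park 2010, §1).
[cite: AkhmedovPark2010, §1 and Thm. 1 (i)] [cite: GompfStipsiczGSM1999, §1.2] -/
theorem akhmedovPark2010_lemma8_invariants_of_homeomorph_model_of_natAbs_signature_eq_one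
    (M : Type) [TopologicalSpace M] [T2Space M] [ChartedSpace (EuclideanSpace ℝ (Fin 4)) M]
    [CompactSpace M] [SimplyConnectedSpace M] (μ : HomologicalOrientation ℤ M 4)
    (hr : Module.finrank ℤ ↥(freeCohomology ℤ M 2) = 3) (hs : μ.signature.natAbs = 1)
    (N : ℕ → Type) [∀ i, TopologicalSpace (N i)] [∀ i, T2Space (N i)]
    [∀ i, SecondCountableTopology (N i)] [∀ i, ChartedSpace (EuclideanSpace ℝ (Fin 4)) (N i)]
    [∀ i, IsManifold (𝓡 4) ∞ (N i)] [∀ i, CompactSpace (N i)]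
    (he : ∀ i, Nonempty (N i ≃ₜ M)) (hN : ∀ i j, Nonempty (N i ≃ₘ⟮𝓡 4, 𝓡 4⟯ N j) → i = j) :
    akhmedovPark2010_lemma8_invariants := by
  rcases Int.natAbs_eq_iff.mp hs with h1 | h1
  · have hneg : (-μ).signature = -1 := by rw [signature_neg_holds μ, h1]; rfl
    exact akhmedovPark2010_lemma8_invariants_of_homeomorph_model M (-μ) hr hneg N he hN
  · exact akhmedovPark2010_lemma8_invariants_of_homeomorph_model M μ hr h1 N he hN

/-- **Given Wall and Freedman, the leaf is EQUIVALENT to the shape of Thm. 1 (i) with the model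
recorded by `π₁ = 1`, `b₂ = 3`, `σ = -1`.** `←` is
`akhmedovPark2010_lemma8_invariants_of_homeomorph_model`; `→` takes the model `M := X 0` and the
homeomorphisms `X i ≃ₜ X 0` from Wall's Thm. 2 (`hW`) and Freedman's Thm. 1.3 (`hF`) through the
sibling theorem `nonempty_homeomorph_of_finrank_eq_three_of_wall_of_freedman` ("From Freedman's
theorem … `X₁(m)` is homeomorphic to `ℂℙ² # 2ℂℙ²bar`", proof of Lemma 8). The right-hand side is
`akhmedovPark2010_exotic_bTwo_three` with its clause `H₂(M; ℤ) ≅ ℤ³` replaced by an orientation of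
`M` with `b₂ = 3`, `σ = -1`. [cite: AkhmedovPark2010, Thm. 1 (i), Lemma 8 and its proof]
[cite: WallJLMS1964, Thm. 2] [cite: FreedmanJDG1982, Thm. 1.3] -/
theorem akhmedovPark2010_lemma8_invariants_iff_homeomorph_model
    (hW : isHCobordant_of_equivalent_intersectionForm)
    (hF : nonempty_homeomorph_of_isHCobordant_four.{0}) :
    akhmedovPark2010_lemma8_invariants ↔
      ∃ (M : Type) (_ : TopologicalSpace M) (_ : T2Space M) (_ : SecondCountableTopology M)
        (_ : ChartedSpace (EuclideanSpace ℝ (Fin 4)) M) (_ : IsManifold (𝓡 4) ∞ M)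
        (_ : CompactSpace M) (_ : SimplyConnectedSpace M) (μ : HomologicalOrientation ℤ M 4)
        (N : ℕ → Type) (_ : ∀ i, TopologicalSpace (N i)) (_ : ∀ i, T2Space (N i))
        (_ : ∀ i, SecondCountableTopology (N i))
        (_ : ∀ i, ChartedSpace (EuclideanSpace ℝ (Fin 4)) (N i))
        (_ : ∀ i, IsManifold (𝓡 4) ∞ (N i)) (_ : ∀ i, CompactSpace (N i)),
        (Module.finrank ℤ ↥(freeCohomology ℤ M 2) = 3 ∧ μ.signature = -1) ∧
          (∀ i, Nonempty (N i ≃ₜ M)) ∧ ∀ i j, Nonempty (N i ≃ₘ⟮𝓡 4, 𝓡 4⟯ N j) → i = j := by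
  constructor
  · rintro ⟨X, i₁, i₂, i₃, i₄, i₅, i₆, i₇, μ, hinv, hinj⟩
    refine ⟨X 0, i₁ 0, i₂ 0, i₃ 0, i₄ 0, i₅ 0, i₆ 0, i₇ 0, μ 0, X, i₁, i₂, i₃, i₄, i₅, i₆,
      hinv 0, fun i => ?_, hinj⟩
    exact nonempty_homeomorph_of_finrank_eq_three_of_wall_of_freedman hW hF (X i) (X 0) (μ i)
      (μ 0) (hinv i).1 (hinv i).2 (hinv 0).1 (hinv 0).2
  · rintro ⟨M, _, _, _, _, _, _, _, μ, N, _, _, _, _, _, _, ⟨hr, hs⟩, he, hN⟩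
    exact akhmedovPark2010_lemma8_invariants_of_homeomorph_model M μ hr hs N he hN

/-! ### §3 What the vendored Thm. 1 (i) gives: the leaf up to the sign class of the model -/

/-- **`b₂` of the model of `akhmedovPark2010_exotic_bTwo_three`**: a simply connected closed
topological 4-manifold `M` with `H₂(M; ℤ) ≅ ℤ³` has `rank H²(M; ℤ)/T = 3`, by the tree's PROVED
`H₂(M; ℤ) ≅ ℤ^{rank H²(M; ℤ)/T}`
(`nonempty_singularHomologyZ_two_iso_of_simplyConnectedSpace_holds`: Hatcher Cor. 3.3, Thm. 3.30,
Thm. 2A.1, Prop. 3.25) and invariance of the rank of a free `ℤ`-module (`ℤʳ ≅ ℤ³ ⇒ r = 3`).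
[cite: HatcherAT2002, Cor. 3.3 with Thm. 3.30] -/
theorem finrank_freeCohomology_two_eq_three_of_iso (M : Type) [TopologicalSpace M] [T2Space M]
    [SecondCountableTopology M] [ChartedSpace (EuclideanSpace ℝ (Fin 4)) M] [CompactSpace M]
    [SimplyConnectedSpace M]
    (hb : Nonempty (singularHomologyZ M 2 ≅ ModuleCat.of ℤ (Fin 3 → ℤ))) :
    Module.finrank ℤ ↥(freeCohomology ℤ M 2) = 3 := by
  obtain ⟨e₃⟩ := hb
  obtain ⟨e⟩ := nonempty_singularHomologyZ_two_iso_of_simplyConnectedSpace_holds M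
  have h := (e.symm ≪≫ e₃).toLinearEquiv.finrank_eq
  change Module.finrank ℤ (Fin _ → ℤ) = Module.finrank ℤ (Fin 3 → ℤ) at h
  simpa only [Module.finrank_fin_fun] using h

/-- **`σ` of the model of `akhmedovPark2010_exotic_bTwo_three`, up to orientation**: a simply
connected closed topological 4-manifold `M` with `H₂(M; ℤ) ≅ ℤ³` carries a `ℤ`-orientation `μ`
with `σ(M, μ) = -1` or `σ(M, μ) = -3`. Indeed `M` is `ℤ`-orientable (Hatcher Prop. 3.25, "`M` is
orientable if it is simply-connected"; PROVED:
`nonempty_homologicalOrientation_int_of_simplyConnectedSpace_holds`),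
`b₂ = 3` (`finrank_freeCohomology_two_eq_three_of_iso`) and `b₂ = b₂⁺ + b₂⁻` (Gompf–Stipsicz
1999, §1.2; PROVED: `finrank_eq_sigPos_add_sigNeg_intersectionForm_holds`), so
`σ = b₂⁺ - b₂⁻ ∈ {±1, ±3}`, and `σ(M, -μ) = -σ(M, μ)` (PROVED: `signature_neg_holds`).
[cite: HatcherAT2002, §3.3 Prop. 3.25] [cite: GompfStipsiczGSM1999, §1.2] -/
theorem exists_signature_eq_neg_one_or_eq_neg_three (M : Type) [TopologicalSpace M] [T2Space M]
    [SecondCountableTopology M] [ChartedSpace (EuclideanSpace ℝ (Fin 4)) M] [CompactSpace M]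
    [SimplyConnectedSpace M]
    (hb : Nonempty (singularHomologyZ M 2 ≅ ModuleCat.of ℤ (Fin 3 → ℤ))) :
    ∃ μ : HomologicalOrientation ℤ M 4, μ.signature = -1 ∨ μ.signature = -3 := by
  have hr := finrank_freeCohomology_two_eq_three_of_iso M hb
  have hμ : ∀ [SimplyConnectedSpace M], Nonempty (HomologicalOrientation ℤ M 4) :=
    nonempty_homologicalOrientation_int_of_simplyConnectedSpace_holds M
  obtain ⟨μ⟩ := hμ
  have hpq := finrank_eq_sigPos_add_sigNeg_intersectionForm_holds (X := M) (k := 2) (n := 4)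
    even_two two_add_two_eq_four μ
  rw [hr] at hpq
  have hσ : μ.signature = (sigPos (intersectionForm two_add_two_eq_four μ).toQuadraticMap : ℤ) -
      sigNeg (intersectionForm two_add_two_eq_four μ).toQuadraticMap := rfl
  have hneg : (-μ).signature = -μ.signature := signature_neg_holds μ
  rcases lt_or_ge μ.signature 0 with hlt | hge
  · exact ⟨μ, by omega⟩
  · exact ⟨-μ, by omega⟩

/-- **Akhmedov–Park's Thm. 1 (i) as vendored gives the leaf up to the sign class of its model.**
From `akhmedovPark2010_exotic_bTwo_three` (a simply connected closed smooth `M` with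
`H₂(M; ℤ) ≅ ℤ³` and closed smooth `N₀, N₁, …`, pairwise non-diffeomorphic, each homeomorphic to
`M`): for some `s ∈ {-1, -3}` there is a sequence of simply connected closed smooth 4-manifolds,
pairwise non-diffeomorphic, with `ℤ`-orientations of `b₂ = 3` and `σ = s` — namely `N` with the
orientations transported from a suitably oriented `M`
(`exists_signature_eq_neg_one_or_eq_neg_three`, §1). With `s = -1` this is
`akhmedovPark2010_lemma8_invariants` verbatim.
[cite: AkhmedovPark2010, Thm. 1 (i) and Lemma 8] -/
theorem exists_family_of_exotic_bTwo_three (h : akhmedovPark2010_exotic_bTwo_three) :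
    ∃ s : ℤ, (s = -1 ∨ s = -3) ∧
      ∃ (X : ℕ → Type) (_ : ∀ m, TopologicalSpace (X m)) (_ : ∀ m, T2Space (X m))
        (_ : ∀ m, SecondCountableTopology (X m))
        (_ : ∀ m, ChartedSpace (EuclideanSpace ℝ (Fin 4)) (X m))
        (_ : ∀ m, IsManifold (𝓡 4) ∞ (X m)) (_ : ∀ m, CompactSpace (X m))
        (_ : ∀ m, SimplyConnectedSpace (X m)) (μ : ∀ m, HomologicalOrientation ℤ (X m) 4),
        (∀ m, Module.finrank ℤ ↥(freeCohomology ℤ (X m) 2) = 3 ∧ (μ m).signature = s) ∧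
          ∀ i j, Nonempty (X i ≃ₘ⟮𝓡 4, 𝓡 4⟯ X j) → i = j := by
  obtain ⟨M, _, _, _, _, _, _, _, N, _, _, _, _, _, _, hb, hN, hinj⟩ := h
  obtain ⟨μ, hμ⟩ := exists_signature_eq_neg_one_or_eq_neg_three M hb
  have hr := finrank_freeCohomology_two_eq_three_of_iso M hb
  have e : ∀ i, N i ≃ₜ M := fun i => (hN i).some
  exact ⟨μ.signature, hμ, N, fun _ => inferInstance, fun _ => inferInstance,
    fun _ => inferInstance, fun _ => inferInstance, fun _ => inferInstance, fun _ => inferInstance,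
    fun i => (e i).toHomotopyEquiv.simplyConnectedSpace, fun i => μ.comap (e i),
    fun i => ⟨(finrank_freeCohomology_eq_of_homeomorph (e i) 2).trans hr,
      signature_comap_holds μ (e i)⟩, hinj⟩

/-- **Hence `akhmedovPark2010_exotic_bTwo_three` implies the leaf OR its definite twin**: either
`akhmedovPark2010_lemma8_invariants` (`σ = -1`, the case "`M = ℂℙ² # 2ℂℙ²bar`" of Thm. 1 (i)), or
the same statement with `σ = -3` (an infinite pairwise non-diffeomorphic family with `b₂ = 3` and
negative definite form — for Thm. 1 (i) as printed this case does not occur,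
`σ(ℂℙ² # 2ℂℙ²bar) = -1`, but the vendored form records the model only through `H₂ ≅ ℤ³` and
cannot exclude it). Together with the sibling
`akhmedovPark2010_exotic_bTwo_three_of_wall_of_freedman_of_lemma8_invariants`
(leaf ⇒ vendored Thm. 1 (i), given Wall and Freedman) this locates the two Akhmedov–Park facts of
the tree relative to each other. [cite: AkhmedovPark2010, Thm. 1 (i) and Lemma 8] -/
theorem akhmedovPark2010_lemma8_invariants_or_of_exotic_bTwo_three
    (h : akhmedovPark2010_exotic_bTwo_three) :
    akhmedovPark2010_lemma8_invariants ∨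
      ∃ (X : ℕ → Type) (_ : ∀ m, TopologicalSpace (X m)) (_ : ∀ m, T2Space (X m))
        (_ : ∀ m, SecondCountableTopology (X m))
        (_ : ∀ m, ChartedSpace (EuclideanSpace ℝ (Fin 4)) (X m))
        (_ : ∀ m, IsManifold (𝓡 4) ∞ (X m)) (_ : ∀ m, CompactSpace (X m))
        (_ : ∀ m, SimplyConnectedSpace (X m)) (μ : ∀ m, HomologicalOrientation ℤ (X m) 4),
        (∀ m, Module.finrank ℤ ↥(freeCohomology ℤ (X m) 2) = 3 ∧ (μ m).signature = -3) ∧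
          ∀ i j, Nonempty (X i ≃ₘ⟮𝓡 4, 𝓡 4⟯ X j) → i = j := by
  obtain ⟨s, hs, X, i₁, i₂, i₃, i₄, i₅, i₆, i₇, μ, hinv, hinj⟩ :=
    exists_family_of_exotic_bTwo_three h
  rcases hs with rfl | rfl
  · exact Or.inl ⟨X, i₁, i₂, i₃, i₄, i₅, i₆, i₇, μ, hinv, hinj⟩
  · exact Or.inr ⟨X, i₁, i₂, i₃, i₄, i₅, i₆, i₇, μ, hinv, hinj⟩

end Literature.Barriers.SmoothPoincare4

end
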